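/-
Copyright (c) 2026. All rights reserved.
Released under Apache 2.0 license as described in the file LICENSE.
Authors: abc-iut cell, campaign-S prover seat abc-iut-S1 (wave 1, gen 7).
-/
import Literature.IUT.LogVolume.UnitLogWildDyadicQuarticPair
import Literature.IUT.LogVolume.UnitLogTorsionPowerCriterion
import HarnessLib

/-!
# Dyadic places with `(e, f) = (4, 1)` containing `√−1`: the `2`-adic logarithm of a unit is never a unit

Proof-only sequel (theorems, no definitions) of `UnitLogWildDyadicQuartic{,Pair}.lean` (abc-iut-S1: at
`(e, f) = (4, 1)` BOTH answers to «does `log₂(𝒪_K^×)` meet `𝒪_K^×`?» occur — `ℚ₂(⁴√2)` no, `ℚ₂(⁴√3)`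
yes) and of abc-iut-w5-d064's `UnitLogTorsionPowerCriterion.lean` (every `K/ℚ₂`: it meets iff
`R^μ·(𝒪_K^×)⁴` meets the sphere `‖1 − w‖ = ‖4‖`).  The fields of [IUTchI] Def. 3.1 contain `√−1`; for
them the residual class `(4, 1)` IS decided.  **Theorem**
(`logUnits_inter_sphere_eq_empty_of_four_of_sq_eq_neg_one`): `e(K/ℚ₂) = 4`, `f(K/ℚ₂) = 1`, `i² = −1`
in `K` ⇒ `log₂(𝒪_K^×) ∩ 𝒪_K^× = ∅`.  Example: `ℚ₂(ζ₈) = ℚ₂(√−1, √2)`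
(`exists_cyclotomic_quartic_logUnits_inter_sphere_eq_empty`); so among `(4,1)`-fields the dichotomy of
the parent files lives entirely on the `√−1 ∉ K` side.

PROOF (classical; Neukirch II (5.5), Koblitz GTM 58 IV §1–2): show `‖1 − ζ·v⁴‖ ≠ ‖4‖` for roots of
unity `ζ` and units `v` (principal, `f = 1`).  `‖1 − v⁴‖ = ‖ϖ‖⁴` if `‖v − 1‖ = ‖ϖ‖`, `≤ ‖ϖ‖⁹` if
`‖v − 1‖ ≤ ‖ϖ‖²`; from `1 − ζv⁴ = (1 − ζ) + ζ(1 − v⁴)`, the second case forces `ζ = 1` (absurd), the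
first `ζ = −1`, and then `1 + v⁴ = (z² + 3)² − 7 + 4z(1 + z²)` (`v = 1 + z`) gives `y = z² + 3` with
`y² = 7 + d`, `‖d‖ = ‖4‖`, so `(iy)² = 1 − 4η`, `η ≡ 1` — insoluble over the residue field `𝔽₂`
(Artin–Schreier).  Only this step uses `i ∈ K`.  Consumer: the cell's (Ind3) honest-model census
([IUTchIII] Rmk. 1.1.1 (i), record only).  Nothing here is disputed mathematics; no IUT statement is
asserted; nothing bears on [IUTchIII] Cor. 3.12.
-/

noncomputable section

open Metric Set

namespace Literature.IUT.LogVolume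

namespace WildDyadicQuartic

open Literature.NumberTheory.GaloisRepresentations.Ultrametric RamificationCriterion

variable {K : Type*} [NontriviallyNormedField K] [instK : NormedAlgebra ℚ_[2] K] [IsUltrametricDist K]
  [ProperSpace K]

omit instK [IsUltrametricDist K] [ProperSpace K] in
/-- Ultrametric bookkeeping: `‖a‖, ‖b‖ ≤ C ⇒ ‖a + b‖ ≤ C`. [folklore] -/
private theorem ultrametric_norm_add_le_of_le [IsUltrametricDist K] {a b : K} {C : ℝ} (ha : ‖a‖ ≤ C)
    (hb : ‖b‖ ≤ C) : ‖a + b‖ ≤ C :=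
  (IsUltrametricDist.norm_add_le_max a b).trans (max_le ha hb)

omit instK [IsUltrametricDist K] [ProperSpace K] in
/-- Discreteness: `‖z‖ < ‖ϖ‖^k ⇒ ‖z‖ ≤ ‖ϖ‖^{k+1}`. [cite: NeukirchANT1999, Ch. II (5.5)] -/
theorem norm_le_zpow_succ_of_norm_lt_zpow {ϖ : Kˣ} (hϖ : IsUniformizer ϖ) {z : K} {k : ℤ}
    (hz : ‖z‖ < ‖(ϖ : K)‖ ^ k) : ‖z‖ ≤ ‖(ϖ : K)‖ ^ (k + 1) := by
  have hρ0 : 0 < ‖(ϖ : K)‖ := norm_units_pos ϖ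
  by_cases hz0 : z = 0
  · rw [hz0, norm_zero]; exact (zpow_pos hρ0 _).le
  obtain ⟨t, ht⟩ := hϖ.2 (Units.mk0 z hz0)
  rw [Units.val_mk0] at ht
  rw [ht] at hz ⊢
  have hkt : k < t := (zpow_lt_zpow_iff_right_of_lt_one₀ hρ0 hϖ.1).mp hz
  exact zpow_le_zpow_right_of_le_one₀ hρ0 hϖ.1.le (by omega)

/-- **`‖v − 1‖ = ‖ϖ‖ ⇒ ‖v⁴ − 1‖ = ‖ϖ‖⁴ (= ‖2‖)`** at `e = 4`: with `v = 1 + z`,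
`v⁴ − 1 = z⁴ + (4z + 6z² + 4z³)` and `z⁴` dominates. [cite: NeukirchANT1999, Ch. II (5.5)] -/
theorem norm_pow_four_sub_one_eq {ϖ : Kˣ} (hϖ : IsUniformizer ϖ) (he : absRamificationIdx 2 K = 4)
    {v : K} (hv : ‖v - 1‖ = ‖(ϖ : K)‖) : ‖v ^ 4 - 1‖ = ‖(ϖ : K)‖ ^ 4 := by
  have hρ0 : 0 < ‖(ϖ : K)‖ := norm_units_pos ϖ
  have hρ1 : ‖(ϖ : K)‖ < 1 := hϖ.1
  have h2 : ‖(2 : K)‖ = ‖(ϖ : K)‖ ^ 4 := by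
    have := norm_prime_eq_norm_pow 2 K hϖ
    rw [he] at this; exact_mod_cast this
  have h4 : ‖(4 : K)‖ = ‖(ϖ : K)‖ ^ 8 := by
    rw [show (4 : K) = 2 * 2 by norm_num, norm_mul, h2, ← pow_add]
  have h6 : ‖(6 : K)‖ = ‖(ϖ : K)‖ ^ 4 := by
    rw [show (6 : K) = 2 * 3 by norm_num, norm_mul, h2,
      show (3 : K) = ((3 : ℕ) : K) by norm_cast, norm_natCast_eq_one_of_not_dvd 2 (by norm_num), mul_one]
  set z : K := v - 1 with hz
  have hz4 : ‖z ^ 4‖ = ‖(ϖ : K)‖ ^ 4 := by rw [norm_pow, hv]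
  have hrest : ‖4 * z + 6 * z ^ 2 + 4 * z ^ 3‖ < ‖(ϖ : K)‖ ^ 4 := by
    have hlt : ‖(ϖ : K)‖ ^ 5 < ‖(ϖ : K)‖ ^ 4 := pow_lt_pow_right_of_lt_one₀ hρ0 hρ1 (by norm_num)
    refine lt_of_le_of_lt ?_ hlt
    refine ultrametric_norm_add_le_of_le (ultrametric_norm_add_le_of_le ?_ ?_) ?_
    · rw [norm_mul, h4, hv, ← pow_succ]
      exact pow_le_pow_of_le_one hρ0.le hρ1.le (by norm_num)
    · rw [norm_mul, h6, norm_pow, hv, ← pow_add]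
      exact pow_le_pow_of_le_one hρ0.le hρ1.le (by norm_num)
    · rw [norm_mul, h4, norm_pow, hv, ← pow_add]
      exact pow_le_pow_of_le_one hρ0.le hρ1.le (by norm_num)
  have hsplit : v ^ 4 - 1 = z ^ 4 + (4 * z + 6 * z ^ 2 + 4 * z ^ 3) := by rw [hz]; ring
  rw [hsplit, IsUltrametricDist.norm_add_eq_max_of_norm_ne_norm (by rw [hz4]; exact ne_of_gt hrest), hz4,
    max_eq_left hrest.le]

/-- **`‖v − 1‖ ≤ ‖ϖ‖² ⇒ ‖v⁴ − 1‖ ≤ ‖ϖ‖⁹ (< ‖4‖)`** at `e = 4`, units principal: `v⁴ − 1 = A(A+2)`,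
`A = v² − 1 ∈ 2𝒪`, and `A/2 ≡ 1` when it is a unit. [cite: NeukirchANT1999, Ch. II (5.5)] -/
theorem norm_pow_four_sub_one_le {ϖ : Kˣ} (hϖ : IsUniformizer ϖ) (he : absRamificationIdx 2 K = 4)
    (hprinc : ∀ u : K, ‖u‖ = 1 → IsPrincipal u) {v : K} (hv : ‖v - 1‖ ≤ ‖(ϖ : K)‖ ^ 2) :
    ‖v ^ 4 - 1‖ ≤ ‖(ϖ : K)‖ ^ 9 := by
  have hρ0 : 0 < ‖(ϖ : K)‖ := norm_units_pos ϖ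
  have hρ1 : ‖(ϖ : K)‖ < 1 := hϖ.1
  have h2 : ‖(2 : K)‖ = ‖(ϖ : K)‖ ^ 4 := by
    have := norm_prime_eq_norm_pow 2 K hϖ
    rw [he] at this; exact_mod_cast this
  have h20 : (2 : K) ≠ 0 := norm_pos_iff.mp (by rw [h2]; positivity)
  set A : K := v ^ 2 - 1 with hA
  have hA4 : ‖A‖ ≤ ‖(ϖ : K)‖ ^ 4 := by
    have h24 : ‖(2 : K)‖ ≤ ‖(ϖ : K)‖ ^ 2 := by
      rw [h2]; exact pow_le_pow_of_le_one hρ0.le hρ1.le (by norm_num)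
    rw [hA, show v ^ 2 - 1 = (v - 1) * ((v - 1) + 2) by ring, norm_mul, show (4 : ℕ) = 2 + 2 by rfl,
      pow_add]
    exact mul_le_mul hv (ultrametric_norm_add_le_of_le hv h24) (norm_nonneg _) (pow_nonneg hρ0.le 2)
  have hfac : v ^ 4 - 1 = A * (A + 2) := by rw [hA]; ring
  rw [hfac, norm_mul, show (9 : ℕ) = 4 + 5 by rfl, pow_add]
  rcases hA4.lt_or_eq with hlt | heq
  · -- `‖A‖ ≤ ‖ϖ‖⁵`, `‖A + 2‖ ≤ ‖ϖ‖⁴`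
    have hA5 : ‖A‖ ≤ ‖(ϖ : K)‖ ^ 5 := by
      have := norm_le_zpow_succ_of_norm_lt_zpow hϖ (k := 4) (by exact_mod_cast hlt)
      exact_mod_cast this
    have hA2 : ‖A + 2‖ ≤ ‖(ϖ : K)‖ ^ 4 := ultrametric_norm_add_le_of_le hA4 (by rw [h2])
    calc ‖A‖ * ‖A + 2‖ ≤ ‖(ϖ : K)‖ ^ 5 * ‖(ϖ : K)‖ ^ 4 :=
          mul_le_mul hA5 hA2 (norm_nonneg _) (pow_nonneg hρ0.le 5)
      _ = ‖(ϖ : K)‖ ^ 4 * ‖(ϖ : K)‖ ^ 5 := mul_comm _ _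
  · -- `A/2` is a unit, hence principal: `‖A + 2‖ ≤ ‖ϖ‖⁵`
    have hc : ‖A / 2‖ = 1 := by rw [norm_div, heq, h2, div_self (pow_pos hρ0 4).ne']
    have hcP : ‖1 - A / 2‖ < 1 := hprinc _ hc
    have hcP' : ‖1 - A / 2‖ ≤ ‖(ϖ : K)‖ := by
      have := norm_le_zpow_succ_of_norm_lt_zpow hϖ (k := 0) (by rw [zpow_zero]; exact hcP)
      rwa [zero_add, zpow_one] at this
    have hA2 : ‖A + 2‖ ≤ ‖(ϖ : K)‖ ^ 5 := by
      rw [show A + 2 = 2 * (2 + -(1 - A / 2)) by field_simp; ring, norm_mul, h2, pow_succ]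
      refine mul_le_mul le_rfl (ultrametric_norm_add_le_of_le ?_ (by rw [norm_neg]; exact hcP'))
        (norm_nonneg _) (pow_nonneg hρ0.le 4)
      rw [h2]
      exact pow_le_of_le_one hρ0.le hρ1.le (by norm_num)
    exact mul_le_mul hA4 hA2 (norm_nonneg _) (pow_nonneg hρ0.le 4)

/-- `2^{1/(2−1)} = 2`: the contraction constant at `p = 2`. [cite: Koblitz1984, Ch. IV §1] -/
private theorem two_rpow_aux : ((2 : ℕ) : ℝ) ^ (1 / (((2 : ℕ) : ℝ) - 1)) = 2 := by norm_num

/-- **A root of unity `ζ` with `‖1 − ζ‖ < 1/2` is `1`** (`log₂` kills `ζ` and is injective there).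
[cite: Koblitz1984, Ch. IV §2] -/
theorem torsion_eq_one_of_norm_one_sub_lt {ζ : K} (hζ : IsTorsionUnit K ζ) (h : ‖1 - ζ‖ < 2⁻¹) :
    ζ = 1 :=
  IsTorsionUnit.eq_one_of_norm_one_sub_le 2 K (ρ := ‖1 - ζ‖) (by rw [two_rpow_aux]; linarith) hζ le_rfl

/-- **A root of unity `ζ` with `‖1 − ζ‖ = 1/2` is `−1`** (units principal): `1 − ζ = 2c`, `c ≡ 1`,
`1 − ζ² = 4c(1 − c)` has norm `< 1/2`, so `ζ² = 1`. [cite: Koblitz1984, Ch. IV §2] -/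
theorem torsion_eq_neg_one_of_norm_one_sub_eq (hprinc : ∀ u : K, ‖u‖ = 1 → IsPrincipal u) {ζ : K}
    (hζ : IsTorsionUnit K ζ) (h : ‖1 - ζ‖ = 2⁻¹) : ζ = -1 := by
  have h2 : ‖(2 : K)‖ = 2⁻¹ := WildDyadic.norm_two
  have h20 : (2 : K) ≠ 0 := norm_pos_iff.mp (by rw [h2]; norm_num)
  set c : K := (1 - ζ) / 2 with hc
  have hc1 : ‖c‖ = 1 := by rw [hc, norm_div, h, h2, div_self (by norm_num : (2⁻¹ : ℝ) ≠ 0)]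
  have hcP : ‖1 - c‖ < 1 := hprinc c hc1
  have hsq : 1 - ζ ^ 2 = 4 * c * (1 - c) := by
    rw [hc]
    field_simp
    ring
  have hζ2 : IsTorsionUnit K (ζ ^ 2) := by
    obtain ⟨n, hn, hn1⟩ := hζ
    exact ⟨n, hn, by rw [← pow_mul, mul_comm, pow_mul, hn1, one_pow]⟩
  have hlt : ‖1 - ζ ^ 2‖ < 2⁻¹ := by
    rw [hsq, norm_mul, norm_mul, show (4 : K) = 2 * 2 by norm_num, norm_mul, h2, hc1, mul_one]
    calc (2⁻¹ : ℝ) * 2⁻¹ * ‖1 - c‖ ≤ 2⁻¹ * 2⁻¹ * 1 := by gcongr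
      _ < 2⁻¹ := by norm_num
  have h1 : ζ ^ 2 = 1 := torsion_eq_one_of_norm_one_sub_lt hζ2 hlt
  have hne : ζ ≠ 1 := by
    rintro rfl
    rw [sub_self, norm_zero] at h
    norm_num at h
  have hfac : (ζ - 1) * (ζ + 1) = 0 := by linear_combination h1
  rcases mul_eq_zero.mp hfac with h0 | h0
  · exact absurd (sub_eq_zero.mp h0) hne
  · linear_combination h0

omit [ProperSpace K] in
/-- **`r² ≠ 1 − 4η` for `η ≡ 1 (mod 𝔪)` when every unit is principal** (`r = 1 + 2δ` would give
`δ² + δ + η = 0`, but `‖δ² + δ‖ < 1 = ‖η‖`: Artin–Schreier over `𝔽₂`). [cite: NeukirchANT1999, Ch. II (5.5)] -/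
theorem sq_ne_one_sub_four_mul (hprinc : ∀ u : K, ‖u‖ = 1 → IsPrincipal u) {η : K} (hη : ‖1 - η‖ < 1)
    (r : K) : r ^ 2 ≠ 1 - 4 * η := by
  intro hr
  have h2 : ‖(2 : K)‖ = 2⁻¹ := WildDyadic.norm_two
  have h4 : ‖(4 : K)‖ = 4⁻¹ := by rw [show (4 : K) = 2 * 2 by norm_num, norm_mul, h2]; norm_num
  have h20 : (2 : K) ≠ 0 := norm_pos_iff.mp (by rw [h2]; norm_num)
  have hη1 : ‖η‖ = 1 := by
    have := IsUltrametricDist.norm_add_eq_max_of_norm_ne_norm (x := (1 : K)) (y := -(1 - η))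
      (by rw [norm_one, norm_neg]; exact ne_of_gt hη)
    rw [norm_one, norm_neg, max_eq_left hη.le, show (1 : K) + -(1 - η) = η by ring] at this
    exact this
  have hr1 : ‖r ^ 2 - 1‖ = 4⁻¹ := by
    rw [hr, show (1 : K) - 4 * η - 1 = -(4 * η) by ring, norm_neg, norm_mul, h4, hη1, mul_one]
  have hrm : ‖r - 1‖ ≤ 2⁻¹ := by
    refine le_of_not_gt fun hgt ↦ ?_
    have hp : ‖r + 1‖ = ‖r - 1‖ := by
      rw [show r + 1 = (r - 1) + 2 by ring]
      have hne : ‖r - 1‖ ≠ ‖(2 : K)‖ := by rw [h2]; exact ne_of_gt hgt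
      rw [IsUltrametricDist.norm_add_eq_max_of_norm_ne_norm hne, h2, max_eq_left hgt.le]
    have : ‖r ^ 2 - 1‖ = ‖r - 1‖ * ‖r - 1‖ := by
      rw [show r ^ 2 - 1 = (r - 1) * (r + 1) by ring, norm_mul, hp]
    rw [hr1] at this
    nlinarith [norm_nonneg (r - 1)]
  set δ : K := (r - 1) / 2 with hδ
  have hδ1 : ‖δ‖ ≤ 1 := by
    rw [hδ, norm_div, h2, div_le_iff₀ (by norm_num : (0 : ℝ) < 2⁻¹), one_mul]
    exact hrm
  have hAS : δ ^ 2 + δ + η = 0 := by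
    have hrδ : r = 1 + 2 * δ := by rw [hδ]; field_simp; ring
    have h4ne : (4 : K) ≠ 0 := by rw [show (4 : K) = 2 * 2 by norm_num]; exact mul_ne_zero h20 h20
    apply mul_left_cancel₀ h4ne
    linear_combination (hrδ ▸ hr : (1 + 2 * δ) ^ 2 = 1 - 4 * η)
  have hsmall : ‖δ ^ 2 + δ‖ < 1 := by
    rw [show δ ^ 2 + δ = δ * (δ + 1) by ring, norm_mul]
    rcases hδ1.lt_or_eq with hlt | heq
    · have : ‖δ + 1‖ ≤ 1 := ultrametric_norm_add_le_of_le hδ1 (by rw [norm_one])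
      calc ‖δ‖ * ‖δ + 1‖ ≤ ‖δ‖ * 1 := by gcongr
        _ < 1 := by rw [mul_one]; exact hlt
    · have hP : ‖1 - δ‖ < 1 := hprinc δ heq
      have : ‖δ + 1‖ < 1 := by
        rw [show δ + 1 = 2 + -(1 - δ) by ring]
        refine (IsUltrametricDist.norm_add_le_max _ _).trans_lt (max_lt ?_ ?_)
        · rw [h2]; norm_num
        · rw [norm_neg]; exact hP
      calc ‖δ‖ * ‖δ + 1‖ ≤ 1 * ‖δ + 1‖ := by gcongr
        _ < 1 := by rw [one_mul]; exact this
  have : η = -(δ ^ 2 + δ) := by linear_combination hAS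
  rw [this, norm_neg] at hη1
  exact absurd hη1 (ne_of_lt hsmall)

/-- **Main lemma**: `e = 4`, units principal, `i² = −1` ⇒ `‖1 − ζ·v⁴‖ ≠ 1/4` for every root of unity
`ζ` and unit `v`. [cite: Koblitz1984, Ch. IV §2] -/
theorem norm_one_sub_torsion_mul_pow_four_ne (he : absRamificationIdx 2 K = 4)
    (hprinc : ∀ u : K, ‖u‖ = 1 → IsPrincipal u) {i : K} (hi : i ^ 2 = -1) {ζ v : K}
    (hζ : IsTorsionUnit K ζ) (hv : ‖v‖ = 1) : ‖1 - ζ * v ^ 4‖ ≠ (4 : ℝ)⁻¹ := by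
  classical
  intro h4
  obtain ⟨ϖ, hϖ⟩ := exists_isUniformizer (F := K)
  have hρ0 : 0 < ‖(ϖ : K)‖ := norm_units_pos ϖ
  have hρ1 : ‖(ϖ : K)‖ < 1 := hϖ.1
  have h2 : ‖(2 : K)‖ = ‖(ϖ : K)‖ ^ 4 := by
    have := norm_prime_eq_norm_pow 2 K hϖ
    rw [he] at this; exact_mod_cast this
  have hρ4 : ‖(ϖ : K)‖ ^ 4 = 2⁻¹ := by rw [← h2]; exact WildDyadic.norm_two
  have hρ8 : ‖(ϖ : K)‖ ^ 8 = 4⁻¹ := by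
    rw [show (8 : ℕ) = 4 + 4 by rfl, pow_add, hρ4]; norm_num
  have hζ1 : ‖ζ‖ = 1 := hζ.norm_eq_one
  have hvP : ‖1 - v‖ < 1 := hprinc v hv
  have hdecomp : 1 - ζ = (1 - ζ * v ^ 4) + ζ * (v ^ 4 - 1) := by ring
  have hv1 : ‖v - 1‖ ≤ ‖(ϖ : K)‖ := by
    have := norm_le_zpow_succ_of_norm_lt_zpow hϖ (k := 0) (z := v - 1)
      (by rw [zpow_zero, norm_sub_rev]; exact hvP)
    rwa [zero_add, zpow_one] at this
  rcases hv1.lt_or_eq with hlt | heq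
  · -- `‖v − 1‖ ≤ ‖ϖ‖²`: then `‖1 − ζ‖ = 1/4`, so `ζ = 1`, absurd
    have hv2 : ‖v - 1‖ ≤ ‖(ϖ : K)‖ ^ 2 := by
      have := norm_le_zpow_succ_of_norm_lt_zpow hϖ (k := 1) (z := v - 1) (by rw [zpow_one]; exact hlt)
      exact_mod_cast this
    have hsmall : ‖ζ * (v ^ 4 - 1)‖ < ‖1 - ζ * v ^ 4‖ := by
      rw [norm_mul, hζ1, one_mul, h4, ← hρ8]
      exact (norm_pow_four_sub_one_le hϖ he hprinc hv2).trans_lt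
        (pow_lt_pow_right_of_lt_one₀ hρ0 hρ1 (by norm_num))
    have hζn : ‖1 - ζ‖ = 4⁻¹ := by
      rw [hdecomp, IsUltrametricDist.norm_add_eq_max_of_norm_ne_norm (ne_of_gt hsmall),
        max_eq_left hsmall.le, h4]
    have hζ' : ζ = 1 := torsion_eq_one_of_norm_one_sub_lt hζ (by rw [hζn]; norm_num)
    rw [hζ', sub_self, norm_zero] at hζn
    norm_num at hζn
  · -- `‖v − 1‖ = ‖ϖ‖`: then `‖1 − ζ‖ = 1/2`, so `ζ = −1`, and `‖1 + v⁴‖ = 1/4`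
    have hbig : ‖1 - ζ * v ^ 4‖ < ‖ζ * (v ^ 4 - 1)‖ := by
      rw [norm_mul, hζ1, one_mul, norm_pow_four_sub_one_eq hϖ he heq, h4, hρ4]
      norm_num
    have hζn : ‖1 - ζ‖ = 2⁻¹ := by
      rw [hdecomp, IsUltrametricDist.norm_add_eq_max_of_norm_ne_norm (ne_of_lt hbig),
        max_eq_right hbig.le, norm_mul, hζ1, one_mul, norm_pow_four_sub_one_eq hϖ he heq, hρ4]
    have hζ' : ζ = -1 := torsion_eq_neg_one_of_norm_one_sub_eq hprinc hζ hζn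
    rw [hζ'] at h4
    set z : K := v - 1 with hz
    have hzn : ‖z‖ = ‖(ϖ : K)‖ := heq
    have hid : 1 - (-1) * v ^ 4 = ((z ^ 2 + 3) ^ 2 - 7) + 4 * z * (1 + z ^ 2) := by rw [hz]; ring
    have h4n : ‖(4 : K)‖ = 4⁻¹ := UnramifiedDyadic.norm_four
    have htail : ‖4 * z * (1 + z ^ 2)‖ < 4⁻¹ := by
      rw [norm_mul, norm_mul, h4n, hzn, ← hρ8]
      have h1z : ‖1 + z ^ 2‖ ≤ 1 :=
        ultrametric_norm_add_le_of_le (by rw [norm_one]) (by rw [norm_pow, hzn]; exact pow_le_one₀ hρ0.le hρ1.le)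
      calc ‖(ϖ : K)‖ ^ 8 * ‖(ϖ : K)‖ * ‖1 + z ^ 2‖ ≤ ‖(ϖ : K)‖ ^ 8 * ‖(ϖ : K)‖ * 1 := by gcongr
        _ < ‖(ϖ : K)‖ ^ 8 * 1 * 1 := by gcongr
        _ = ‖(ϖ : K)‖ ^ 8 := by ring
    have hy : ‖(z ^ 2 + 3) ^ 2 - 7‖ = 4⁻¹ := by
      have hsub : (z ^ 2 + 3) ^ 2 - 7 = (1 - (-1) * v ^ 4) + -(4 * z * (1 + z ^ 2)) := by rw [hid]; ring
      have hne : ‖1 - (-1) * v ^ 4‖ ≠ ‖-(4 * z * (1 + z ^ 2))‖ := by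
        rw [h4, norm_neg]; exact (ne_of_lt htail).symm
      rw [hsub, IsUltrametricDist.norm_add_eq_max_of_norm_ne_norm hne, h4, norm_neg,
        max_eq_left htail.le]
    set y : K := z ^ 2 + 3 with hydef
    set d : K := y ^ 2 - 7 with hd
    have h40 : (4 : K) ≠ 0 := norm_pos_iff.mp (by rw [h4n]; norm_num)
    have hd4 : ‖d / 4‖ = 1 := by rw [norm_div, hy, h4n, div_self (by norm_num : (4⁻¹ : ℝ) ≠ 0)]
    have hηP : ‖1 - (2 + d / 4)‖ < 1 := by
      rw [show (1 : K) - (2 + d / 4) = (1 - d / 4) + -2 by ring]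
      refine (IsUltrametricDist.norm_add_le_max _ _).trans_lt (max_lt (hprinc _ hd4) ?_)
      rw [norm_neg, WildDyadic.norm_two]; norm_num
    have hsq : (i * y) ^ 2 = 1 - 4 * (2 + d / 4) := by
      rw [mul_pow, hi, hd]
      field_simp
      ring
    exact sq_ne_one_sub_four_mul hprinc hηP (i * y) hsq

/-- **`e(K/ℚ₂) = 4`, `f(K/ℚ₂) = 1`, `√−1 ∈ K` ⇒ `log₂(𝒪_K^×)` MISSES the unit sphere** (torsion–power
criterion + the main lemma). Examples: `ℚ₂(ζ₈) = ℚ₂(√−1, √2)`, every `ℚ₂(√−1, √γ)` with `(e, f) = (4, 1)`.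
[cite: Koblitz1984, Ch. IV §2] -/
theorem logUnits_inter_sphere_eq_empty_of_four_of_sq_eq_neg_one (he : absRamificationIdx 2 K = 4)
    (hf : residueDegree 2 K = 1) {i : K} (hi : i ^ 2 = -1) : logUnits K ∩ sphere 0 1 = ∅ :=
  TorsionPowerCriterion.Dyadic.logUnits_inter_sphere_eq_empty_of_forall fun _ _ hζ hv ↦
    norm_one_sub_torsion_mul_pow_four_ne he (fun _ hu ↦ WildDyadic.isPrincipal_of_residueDegree_eq_one hf hu)
      hi hζ hv

/-- … equivalently `‖log₂ u‖ ≠ 1` for every `u : K`. [cite: Koblitz1984, Ch. IV §2] -/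
theorem norm_unitLog_ne_one_of_four_of_sq_eq_neg_one (he : absRamificationIdx 2 K = 4)
    (hf : residueDegree 2 K = 1) {i : K} (hi : i ^ 2 = -1) (u : K) : ‖unitLog u‖ ≠ 1 := by
  intro hu1
  by_cases hu : ‖u‖ = 1
  · have hmem : unitLog u ∈ logUnits K ∩ sphere 0 1 :=
      ⟨unitLog_mem_logUnits hu, mem_sphere_zero_iff_norm.mpr hu1⟩
    rw [logUnits_inter_sphere_eq_empty_of_four_of_sq_eq_neg_one he hf hi] at hmem
    exact hmem
  · rw [unitLog_of_norm_ne_one hu, norm_zero] at hu1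
    exact zero_ne_one hu1

section AlgCl

open Polynomial IntermediateField

/-- **`ℚ₂(ζ₈) = ℚ₂(√−1, √2) ⊆ ℚ̄₂`** (`ζ⁴ = −1`): degree `≤ 4`, `‖(ζ − 1)⁴‖ = ‖6ζ² − 4ζ(1 + ζ²)‖ = ‖2‖`
so `(e, f) = (4, 1)`; `(ζ²)² = −1`; hence `log₂(𝒪^×) ∩ 𝒪^× = ∅` — the prototype `(4,1)`-place of a field
containing `√−1` ([IUTchI] Def. 3.1). [cite: Koblitz1984, Ch. IV §2] -/
theorem exists_cyclotomic_quartic_logUnits_inter_sphere_eq_empty :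
    ∃ (E : IntermediateField ℚ_[2] (PadicAlgCl 2)) (_ : FiniteDimensional ℚ_[2] E),
      absRamificationIdx 2 E = 4 ∧ residueDegree 2 E = 1 ∧ (∃ i : E, i ^ 2 = -1) ∧
        logUnits E ∩ sphere 0 1 = ∅ := by
  obtain ⟨β, hβ⟩ := IsAlgClosed.exists_pow_nat_eq (-1 : PadicAlgCl 2) (by norm_num : 0 < 4)
  have heval : Polynomial.aeval β (X ^ 4 - C (-1 : ℚ_[2])) = 0 := by
    simp [hβ]
  have hint : IsIntegral ℚ_[2] β := ⟨X ^ 4 - C (-1), monic_X_pow_sub_C (-1) (by norm_num), by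
    simpa [Polynomial.aeval_def] using heval⟩
  haveI hfd : FiniteDimensional ℚ_[2] ℚ_[2]⟮β⟯ := adjoin.finiteDimensional hint
  have hζ : (⟨β, mem_adjoin_simple_self ℚ_[2] β⟩ : ℚ_[2]⟮β⟯) ^ 4 = -1 := by
    apply Subtype.ext
    have hm1E : ((-1 : ℚ_[2]⟮β⟯) : PadicAlgCl 2) = -1 := by
      rw [show (-1 : ℚ_[2]⟮β⟯) = -(1 : ℚ_[2]⟮β⟯) by rfl]
      simp
    simp [hβ, hm1E]
  set ζ : ℚ_[2]⟮β⟯ := ⟨β, mem_adjoin_simple_self ℚ_[2] β⟩ with hζdef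
  have hdeg : Module.finrank ℚ_[2] ℚ_[2]⟮β⟯ ≤ 4 := by
    rw [adjoin.finrank hint]
    have hdvd : minpoly ℚ_[2] β ∣ X ^ 4 - C (-1) := minpoly.dvd ℚ_[2] β heval
    have hne : (X ^ 4 - C (-1 : ℚ_[2])) ≠ 0 := (monic_X_pow_sub_C (-1) (by norm_num)).ne_zero
    calc (minpoly ℚ_[2] β).natDegree ≤ (X ^ 4 - C (-1 : ℚ_[2])).natDegree := natDegree_le_of_dvd hdvd hne
      _ = 4 := natDegree_X_pow_sub_C
  have hζ1 : ‖ζ‖ = 1 := by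
    have h1 : ‖ζ‖ ^ 4 = 1 := by rw [← norm_pow, hζ, norm_neg, norm_one]
    exact (pow_eq_one_iff_of_nonneg (norm_nonneg ζ) (by norm_num)).mp h1
  have h3n : ‖(3 : ℚ_[2]⟮β⟯)‖ = 1 := by
    exact_mod_cast norm_natCast_eq_one_of_not_dvd 2 (K := ℚ_[2]⟮β⟯) (m := 3) (by norm_num)
  have hid : (ζ - 1) ^ 4 = 6 * ζ ^ 2 + -(4 * ζ * (1 + ζ ^ 2)) := by
    have hexp : (ζ - 1) ^ 4 = ζ ^ 4 - 4 * ζ ^ 3 + 6 * ζ ^ 2 - 4 * ζ + 1 := by ring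
    rw [hexp, hζ]
    ring
  have h6 : ‖(6 : ℚ_[2]⟮β⟯) * ζ ^ 2‖ = 2⁻¹ := by
    rw [norm_mul, show (6 : ℚ_[2]⟮β⟯) = 2 * 3 by norm_num, norm_mul, WildDyadic.norm_two, h3n, norm_pow,
      hζ1]
    norm_num
  have hsmall : ‖-(4 * ζ * (1 + ζ ^ 2) : ℚ_[2]⟮β⟯)‖ ≤ 4⁻¹ := by
    rw [norm_neg, norm_mul, norm_mul, UnramifiedDyadic.norm_four, hζ1, mul_one]
    have h1 : ‖1 + ζ ^ 2‖ ≤ 1 :=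
      ultrametric_norm_add_le_of_le (by rw [norm_one]) (by rw [norm_pow, hζ1, one_pow])
    calc (4⁻¹ : ℝ) * ‖1 + ζ ^ 2‖ ≤ 4⁻¹ * 1 := by gcongr
      _ = 4⁻¹ := mul_one _
  have hnorm : ‖ζ - 1‖ ^ 4 = 2⁻¹ := by
    rw [← norm_pow, hid]
    have hlt : ‖-(4 * ζ * (1 + ζ ^ 2) : ℚ_[2]⟮β⟯)‖ < ‖(6 : ℚ_[2]⟮β⟯) * ζ ^ 2‖ := by
      rw [h6]
      exact hsmall.trans_lt (by norm_num)
    rw [IsUltrametricDist.norm_add_eq_max_of_norm_ne_norm (ne_of_gt hlt), max_eq_left hlt.le, h6]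
  obtain ⟨he, hf⟩ := absRamificationIdx_eq_four_of_norm_pow_four ℚ_[2]⟮β⟯ hdeg hnorm
  have hi : (ζ ^ 2) ^ 2 = -1 := by rw [← pow_mul]; exact hζ
  exact ⟨ℚ_[2]⟮β⟯, hfd, he, hf, ⟨ζ ^ 2, hi⟩,
    logUnits_inter_sphere_eq_empty_of_four_of_sq_eq_neg_one he hf hi⟩

end AlgCl

end WildDyadicQuartic

end Literature.IUT.LogVolume

end
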